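import Summits.Schanuel.Schanuel.Theorems.RootDecomp1KHyper17

/-!
# RootDecomp1KHyper — part 18 of the «HyperCarving» port wave (lens 6, gen 9 = ROUND 4 of route-Schanuel-RootDecomp1K; 19 parts planned)

Mechanical port (census-1 gen 7, dependency closure; tools census/tools/gen7/portkit2.py + build_l6g9.py) of §17 of HOME/decomp-schanuel-lens-6/g9/HyperCarving.lean
(sha256 aba5c91f…, 8041 l; critic CLEARED FOR TYPING 2026-08-30T13:33:07Z; writer PATH A″ rev 5–8) together with the §§0–16 declarations it depends on
(nothing of the node was in the tree before except RootDecomp1KLinLiouvilleSplit and the Literature fact NesterenkoWaldschmidt1996_thm_5_1).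
This part: node lines 7390–7755 (11 declarations: weakMeasure_of_logTypeMeasure, MvWeakMeasure, mvaeval_ne_zero_of_mvWeakMeasure, MvPolyMeasure.mvWeakMeasure, algebraicIndependent_of_mvWeakMeasure, no_int_relation_of_mvWeakMeasure_hyperLiouville …).
All parts share the namespace `Summit.Schanuel.Schanuel.Theorems.RootDecomp1KHyper` (node sub-namespace `HyperCell` reproduced); statements and proofs
are the node's verbatim; `--supports stmt-Schanuel-33363` (A₄ʰ HyperLiouvilleSchanuel). Sorry-free; standard axioms. Nothing here proves Schanuel; rung 0.
-/

set_option linter.dupNamespace false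
set_option linter.unusedSectionVars false

noncomputable section

open Complex IntermediateField Filter Polynomial

namespace Summit.Schanuel.Schanuel.Theorems.RootDecomp1KHyper

variable {n K : ℕ}

namespace HyperCell

variable {n K : ℕ}

/-- `exp(−x) ≤ 1/x` for `x > 0`. -/
private theorem exp_neg_le_one_div {x : ℝ} (hx : 0 < x) : Real.exp (-x) ≤ 1 / x := by
  rw [Real.exp_neg, ← one_div]
  exact one_div_le_one_div_of_le hx (by linarith [Real.add_one_le_exp x])

/-- **A Lang-type measure is a weak measure.** If for each degree `d` there are `A ≥ 0`, `B`, `τ`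
with `|P(θ)| ≥ exp(−(A·log H + B)^τ)` whenever `deg P ≤ d`, `16 ≤ H`, `len P ≤ H` (the shape of
every «transcendence type» statement, read at fixed degree), then `WeakMeasure θ` — with `k = τ`
and `C = (A + |B|)^τ · 17^τ`, reading the measure at `H = len P + 16 ≤ 17·len P` and using
`log H ≤ H`.  This is the bridge by which the printed finite-type measures feed the round-4
extraction (they do NOT feed round 3's, which needs `τ = 1`). -/
theorem weakMeasure_of_logTypeMeasure {θ : ℂ}
    (h : ∀ d : ℕ, ∃ (A B : ℝ) (τ : ℕ), 0 ≤ A ∧ ∀ (P : ℤ[X]) (H : ℕ), P ≠ 0 → P.natDegree ≤ d →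
      16 ≤ H → len P ≤ (H : ℤ) → Real.exp (-((A * Real.log H + B) ^ τ)) ≤ ‖aeval θ P‖) :
    WeakMeasure θ := by
  intro d
  obtain ⟨A, B, τ, hA, hmeas⟩ := h d
  refine ⟨((A + |B| + 1) * 17) ^ τ, τ, by positivity, fun P hP hdeg => ?_⟩
  set H : ℕ := (len P).toNat + 16 with hH
  have hlen1 : 1 ≤ len P := one_le_len hP
  have hH16 : 16 ≤ H := by omega
  have hHZ : (H : ℤ) = ((len P).toNat : ℤ) + 16 := by rw [hH]; push_cast; ring
  have ht : len P ≤ ((len P).toNat : ℤ) := Int.self_le_toNat _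
  have ht' : ((len P).toNat : ℤ) ≤ len P := by rw [Int.toNat_of_nonneg (len_nonneg P)]
  have hlenH : len P ≤ (H : ℤ) := by rw [hHZ]; linarith
  have hH17Z : (H : ℤ) ≤ 17 * len P := by rw [hHZ]; linarith
  have hH17 : (H : ℝ) ≤ 17 * ((len P : ℤ) : ℝ) := by exact_mod_cast hH17Z
  have hL1 : (1 : ℝ) ≤ ((len P : ℤ) : ℝ) := by exact_mod_cast hlen1
  have hw := hmeas P H hP hdeg hH16 hlenH
  have hHpos : (0 : ℝ) < H := by exact_mod_cast (show 0 < H by omega)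
  have hlogH0 : 0 ≤ Real.log H := Real.log_nonneg (by exact_mod_cast (show 1 ≤ H by omega))
  have hlogH : Real.log H ≤ H := (Real.log_le_sub_one_of_pos hHpos).trans (by linarith)
  -- (A log H + B) ≤ (A + |B| + 1) · 17 · len P
  have hbase : A * Real.log H + B ≤ (A + |B| + 1) * 17 * ((len P : ℤ) : ℝ) := by
    have h1 : A * Real.log H ≤ A * (17 * ((len P : ℤ) : ℝ)) :=
      mul_le_mul_of_nonneg_left (hlogH.trans hH17) hA
    have h2 : B ≤ |B| * (17 * ((len P : ℤ) : ℝ)) := by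
      calc B ≤ |B| := le_abs_self B
        _ = |B| * 1 := (mul_one _).symm
        _ ≤ |B| * (17 * ((len P : ℤ) : ℝ)) := by gcongr; linarith
    have h3 : (0 : ℝ) ≤ 1 * (17 * ((len P : ℤ) : ℝ)) := by positivity
    nlinarith
  have habs : |A * Real.log H + B| ≤ (A + |B| + 1) * 17 * ((len P : ℤ) : ℝ) := by
    rw [abs_le]
    refine ⟨?_, hbase⟩
    have h2 : -B ≤ |B| * (17 * ((len P : ℤ) : ℝ)) := by
      calc -B ≤ |B| := neg_le_abs B
        _ = |B| * 1 := (mul_one _).symm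
        _ ≤ |B| * (17 * ((len P : ℤ) : ℝ)) := by gcongr; linarith
    have h1 : 0 ≤ A * Real.log H := mul_nonneg hA hlogH0
    nlinarith
  have hpow : (A * Real.log H + B) ^ τ ≤ ((A + |B| + 1) * 17) ^ τ * ((len P : ℤ) : ℝ) ^ τ := by
    calc (A * Real.log H + B) ^ τ ≤ |A * Real.log H + B| ^ τ := by
          rw [← abs_pow]; exact le_abs_self _
      _ ≤ ((A + |B| + 1) * 17 * ((len P : ℤ) : ℝ)) ^ τ :=
          pow_le_pow_left₀ (abs_nonneg _) habs τ
      _ = ((A + |B| + 1) * 17) ^ τ * ((len P : ℤ) : ℝ) ^ τ := by rw [← mul_pow]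
  calc Real.exp (-(((A + |B| + 1) * 17) ^ τ * ((len P : ℤ) : ℝ) ^ τ))
      ≤ Real.exp (-((A * Real.log H + B) ^ τ)) := Real.exp_le_exp.mpr (neg_le_neg hpow)
    _ ≤ ‖aeval θ P‖ := hw

/-- **Simultaneous weak measure of a tuple** (every total degree). -/
def MvWeakMeasure {n : ℕ} (θ : Fin n → ℂ) : Prop :=
  ∀ d : ℕ, ∃ (C : ℝ) (k : ℕ), 0 < C ∧ ∀ P : MvPolynomial (Fin n) ℤ, P ≠ 0 → P.totalDegree ≤ d →
    Real.exp (-(C * ((mvlen P : ℤ) : ℝ) ^ k)) ≤ ‖MvPolynomial.aeval θ P‖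

/-- §17k. The engine at every level: hyper-Liouville numbers are algebraically independent: auxiliary statement `mvaeval_ne_zero_of_mvWeakMeasure` (lens 6 gen 9 node, ported verbatim). -/
theorem mvaeval_ne_zero_of_mvWeakMeasure {n : ℕ} {θ : Fin n → ℂ} (hθ : MvWeakMeasure θ)
    {P : MvPolynomial (Fin n) ℤ} (hP : P ≠ 0) : MvPolynomial.aeval θ P ≠ 0 := by
  intro h0
  obtain ⟨C, k, _, h⟩ := hθ P.totalDegree
  have h1 := h P hP le_rfl
  rw [h0, norm_zero] at h1
  exact absurd h1 (not_le.mpr (Real.exp_pos _))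

/-- `MvPolyMeasure ⇒ MvWeakMeasure`. -/
theorem MvPolyMeasure.mvWeakMeasure {n : ℕ} {θ : Fin n → ℂ} (hθ : MvPolyMeasure θ) :
    MvWeakMeasure θ := by
  intro d
  obtain ⟨C, τ, hC, h⟩ := hθ d
  refine ⟨C, τ, hC, fun P hP hdeg => ?_⟩
  have h1 := h P hP hdeg
  have hL1 : (1 : ℝ) ≤ ((mvlen P : ℤ) : ℝ) := by exact_mod_cast one_le_mvlen hP
  have hy : 0 < C * ((mvlen P : ℤ) : ℝ) ^ τ := by positivity
  have h2 : (C * ((mvlen P : ℤ) : ℝ) ^ τ)⁻¹ ≤ ‖MvPolynomial.aeval θ P‖ := by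
    rw [inv_le_iff_one_le_mul₀ hy]; linarith [h1]
  calc Real.exp (-(C * ((mvlen P : ℤ) : ℝ) ^ τ)) ≤ 1 / (C * ((mvlen P : ℤ) : ℝ) ^ τ) :=
        exp_neg_le_one_div hy
    _ = (C * ((mvlen P : ℤ) : ℝ) ^ τ)⁻¹ := one_div _
    _ ≤ ‖MvPolynomial.aeval θ P‖ := h2

/-- A tuple with an `MvWeakMeasure` is algebraically independent over `ℚ`. -/
theorem algebraicIndependent_of_mvWeakMeasure {n : ℕ} {θ : Fin n → ℂ} (hθ : MvWeakMeasure θ) :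
    AlgebraicIndependent ℚ θ := by
  rw [algebraicIndependent_iff]
  intro g hg
  obtain ⟨N, G, hN, hG⟩ := exists_int_mul_eq_map g
  by_contra hg0
  have hG0 : G ≠ 0 := by
    intro h0
    rw [h0, map_zero, eq_comm, mul_eq_zero] at hG
    rcases hG with h | h
    · exact hN (by exact_mod_cast (MvPolynomial.C_eq_zero.mp h))
    · exact hg0 h
  have hval : MvPolynomial.aeval θ G = 0 := by
    rw [← mvaeval_int_map θ G, hG, map_mul, hg, mul_zero]
  exact mvaeval_ne_zero_of_mvWeakMeasure hθ hG0 hval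

/-- **Hyper-Liouville extraction in several variables (kernel).** No relation
`Σ_{k ≤ K} G_k(θ) ρ^k = 0`, `G_k ∈ ℤ[X₁, …, Xₙ]` not all zero, between a tuple `θ` with an
`MvWeakMeasure` and a hyper-Liouville real `ρ`. -/
theorem no_int_relation_of_mvWeakMeasure_hyperLiouville {n : ℕ} {θ : Fin n → ℂ}
    (hθ : MvWeakMeasure θ) {ρ : ℝ} (hρ : HyperLiouville ρ) {K : ℕ}
    (G : Fin (K + 1) → MvPolynomial (Fin n) ℤ) (hG : ∃ k, G k ≠ 0)
    (hrel : ∑ k : Fin (K + 1), MvPolynomial.aeval θ (G k) * (ρ : ℂ) ^ (k : ℕ) = 0) : False := by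
  -- the complex polynomial μ(Y) = Σ_k G_k(θ) Y^k
  set μ : ℂ[X] := ∑ k : Fin (K + 1), C (MvPolynomial.aeval θ (G k)) * X ^ (k : ℕ) with hμdef
  have hμeval : ∀ y : ℂ, μ.eval y =
      ∑ k : Fin (K + 1), MvPolynomial.aeval θ (G k) * y ^ (k : ℕ) := by
    intro y
    simp only [hμdef, eval_finsetSum, eval_mul, eval_C, eval_pow, eval_X]
  have hμcoeff : ∀ k : Fin (K + 1), μ.coeff k = MvPolynomial.aeval θ (G k) := by
    intro k
    simp only [hμdef, finsetSum_coeff, coeff_C_mul, coeff_X_pow]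
    rw [Finset.sum_eq_single k]
    · simp
    · intro j _ hjk
      have : (k : ℕ) ≠ (j : ℕ) := fun h => hjk (Fin.ext h).symm
      simp [this]
    · intro h; exact absurd (Finset.mem_univ k) h
  have hμ0 : μ ≠ 0 := by
    obtain ⟨k, hk⟩ := hG
    intro h0
    have h1 : μ.coeff k = 0 := by rw [h0, coeff_zero]
    rw [hμcoeff] at h1
    exact mvaeval_ne_zero_of_mvWeakMeasure hθ hk h1
  have hroot : μ.eval (ρ : ℂ) = 0 := by rw [hμeval]; exact hrel
  obtain ⟨δ, hδ, hδroot⟩ := exists_ball_eval_ne_zero μ hμ0 ρ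
  obtain ⟨M, hM, hLip⟩ := exists_lipschitz_at_root μ ρ hroot
  -- sizes
  set D : ℕ := Finset.univ.sup fun k : Fin (K + 1) => (G k).totalDegree with hDdef
  have hD : ∀ k, (G k).totalDegree ≤ D := fun k =>
    Finset.le_sup (f := fun k : Fin (K + 1) => (G k).totalDegree) (Finset.mem_univ k)
  obtain ⟨Cm, kk, hCm, hmeas⟩ := hθ D
  set Λ : ℤ := ∑ k : Fin (K + 1), mvlen (G k) with hΛ
  have hΛ0 : 0 ≤ Λ := Finset.sum_nonneg fun _ _ => mvlen_nonneg _
  set A : ℕ := ⌈|ρ|⌉₊ + 2 with hA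
  set Cq : ℕ := Λ.toNat * A ^ K + 3 with hCq
  set m : ℕ := K * kk + K + 1 with hm
  set Q₀ : ℝ := Cm * (Cq : ℝ) ^ kk + M + δ⁻¹ + 2 with hQ₀
  -- a hyper-Liouville approximation with a large denominator
  obtain ⟨r, hden, hne, hlt⟩ := hρ (max m (⌈Q₀⌉₊ + 1))
  set q : ℕ := r.den with hq
  set p : ℤ := r.num with hp
  have hMCE : 0 ≤ Cm * (Cq : ℝ) ^ kk := by positivity
  have hδinv : 0 < δ⁻¹ := inv_pos.mpr hδ
  have hqQ : Q₀ < q := by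
    have h1 : ⌈Q₀⌉₊ + 1 ≤ q := (le_max_right _ _).trans hden
    have h2 : Q₀ ≤ ⌈Q₀⌉₊ := Nat.le_ceil _
    have h3 : ((⌈Q₀⌉₊ + 1 : ℕ) : ℝ) ≤ q := by exact_mod_cast h1
    push_cast at h3
    linarith
  have hq2 : (2 : ℝ) < q := by
    have : (2 : ℝ) ≤ Q₀ := by rw [hQ₀]; linarith
    linarith
  have hq1 : (1 : ℝ) < q := by linarith
  have hqpos : (0 : ℝ) < q := by linarith
  have hqR : (q : ℝ) ≠ 0 := hqpos.ne'
  have hq0 : q ≠ 0 := by rintro h; rw [h] at hqpos; simp at hqpos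
  have hqinvδ : (q : ℝ)⁻¹ < δ := by
    have h1 : δ⁻¹ < q := by rw [hQ₀] at hqQ; linarith
    exact (inv_lt_comm₀ hδ hqpos).mp h1
  -- x := r = p/q as a real number
  set x : ℝ := (r : ℝ) with hx
  have hxpq : x = (p : ℝ) / q := by rw [hx, hp, hq]; exact Rat.cast_def r
  have hxρ : |x - ρ| < Real.exp (-(q : ℝ) ^ m) := by
    rw [abs_sub_comm]
    refine hlt.trans_le (Real.exp_le_exp.mpr (neg_le_neg ?_))
    exact pow_le_pow_right₀ hq1.le (le_max_left _ _)
  have hqm1 : Real.exp (-(q : ℝ) ^ m) ≤ (q : ℝ)⁻¹ := by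
    have h1 : (q : ℝ) ≤ (q : ℝ) ^ m := le_self_pow₀ hq1.le (by omega)
    calc Real.exp (-(q : ℝ) ^ m) ≤ Real.exp (-(q : ℝ)) := Real.exp_le_exp.mpr (by linarith)
      _ ≤ 1 / (q : ℝ) := exp_neg_le_one_div hqpos
      _ = (q : ℝ)⁻¹ := one_div _
  have hxρ1 : |x - ρ| ≤ 1 := by
    have : (q : ℝ)⁻¹ ≤ 1 := inv_le_one_of_one_le₀ hq1.le
    linarith
  have hxρδ : |x - ρ| < δ := by linarith
  have hxne : x ≠ ρ := fun h => hne (by rw [← h])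
  -- (1) μ(x) ≠ 0
  have hμx : μ.eval (x : ℂ) ≠ 0 := hδroot x hxne hxρδ
  -- (2) the integer polynomial H = q^K P(X, p/q) and its value at θ
  set H : MvPolynomial (Fin n) ℤ := mvspecialise G p q with hH
  have hxC : ((x : ℝ) : ℂ) = (p : ℂ) / (q : ℂ) := by rw [hxpq]; push_cast; rfl
  have hHe : MvPolynomial.aeval θ H = (q : ℂ) ^ K * μ.eval (x : ℂ) := by
    rw [hH, mvaeval_mvspecialise G p hq0 θ, hμeval, hxC]
  have hqC : (q : ℂ) ≠ 0 := by exact_mod_cast hq0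
  have hH0 : H ≠ 0 := by
    intro h0
    have : (q : ℂ) ^ K * μ.eval (x : ℂ) = 0 := by rw [← hHe, h0, map_zero]
    rcases mul_eq_zero.mp this with h | h
    · exact pow_ne_zero K hqC h
    · exact hμx h
  -- (3) upper bound
  have hup : ‖MvPolynomial.aeval θ H‖ < (q : ℝ) ^ K * M * Real.exp (-(q : ℝ) ^ m) := by
    rw [hHe, norm_mul, norm_pow, Complex.norm_natCast]
    calc (q : ℝ) ^ K * ‖μ.eval (x : ℂ)‖ ≤ (q : ℝ) ^ K * (M * |x - ρ|) := by
          gcongr; exact hLip x hxρ1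
      _ < (q : ℝ) ^ K * (M * Real.exp (-(q : ℝ) ^ m)) := by gcongr
      _ = _ := by ring
  -- (4) the length of H
  have hdegH : H.totalDegree ≤ D := totalDegree_mvspecialise_le G p q hD
  have hpq_bound : (|p| : ℤ) + q ≤ (A : ℤ) * q := by
    have h2 : |(p : ℝ) / q| ≤ |ρ| + 1 := by
      calc |(p : ℝ) / q| = |(x - ρ) + ρ| := by rw [hxpq]; ring_nf
        _ ≤ |x - ρ| + |ρ| := abs_add_le _ _
        _ ≤ |ρ| + 1 := by linarith
    rw [abs_div, abs_of_pos hqpos, div_le_iff₀ hqpos] at h2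
    have h3 : |ρ| ≤ ⌈|ρ|⌉₊ := Nat.le_ceil _
    have h4a : (|ρ| + 1) * (q : ℝ) ≤ ((⌈|ρ|⌉₊ : ℝ) + 1) * q :=
      mul_le_mul_of_nonneg_right (by linarith) hqpos.le
    have h4 : |(p : ℝ)| + q ≤ ((⌈|ρ|⌉₊ : ℝ) + 2) * q := by linarith
    have h5 : (((|p| + q : ℤ)) : ℝ) ≤ (((A : ℤ) * q : ℤ) : ℝ) := by
      rw [hA]; push_cast; linarith
    exact_mod_cast h5
  have hpq0 : (0 : ℤ) ≤ |p| + q := by positivity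
  have hlenH : mvlen H ≤ ((Cq * q ^ K : ℕ) : ℤ) := by
    calc mvlen H ≤ (|p| + q) ^ K * Λ := mvlen_mvspecialise_le G p q
      _ ≤ ((A : ℤ) * q) ^ K * Λ := by gcongr
      _ = (A : ℤ) ^ K * (q : ℤ) ^ K * Λ := by ring
      _ ≤ (A : ℤ) ^ K * (q : ℤ) ^ K * Λ.toNat + 3 * (q : ℤ) ^ K := by
          have h1 : Λ ≤ Λ.toNat := Int.self_le_toNat Λ
          have h2 : (0 : ℤ) ≤ (A : ℤ) ^ K * (q : ℤ) ^ K := by positivity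
          have h3 : (0 : ℤ) ≤ 3 * (q : ℤ) ^ K := by positivity
          exact le_add_of_le_of_nonneg (mul_le_mul_of_nonneg_left h1 h2) h3
      _ = ((Cq * q ^ K : ℕ) : ℤ) := by rw [hCq]; push_cast; ring
  have hlenR : ((mvlen H : ℤ) : ℝ) ≤ (Cq : ℝ) * (q : ℝ) ^ K := by
    have h1 : (((mvlen H : ℤ)) : ℝ) ≤ (((Cq * q ^ K : ℕ) : ℤ) : ℝ) := by exact_mod_cast hlenH
    have h2 : (((Cq * q ^ K : ℕ) : ℤ) : ℝ) = (Cq : ℝ) * (q : ℝ) ^ K := by push_cast; ring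
    rw [← h2]; exact h1
  have hlen0 : (0 : ℝ) ≤ ((mvlen H : ℤ) : ℝ) := by exact_mod_cast mvlen_nonneg H
  -- (5) the lower bound of the measure
  have hlow : Real.exp (-(Cm * ((mvlen H : ℤ) : ℝ) ^ kk)) ≤ ‖MvPolynomial.aeval θ H‖ :=
    hmeas H hH0 hdegH
  have hlow' : Real.exp (-(Cm * ((Cq : ℝ) * (q : ℝ) ^ K) ^ kk)) ≤ ‖MvPolynomial.aeval θ H‖ := by
    refine le_trans (Real.exp_le_exp.mpr (neg_le_neg ?_)) hlow
    gcongr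
  -- (6) the clash
  have hchain := hlow'.trans_lt hup
  set a : ℝ := (q : ℝ) ^ K with ha
  set b : ℝ := (q : ℝ) ^ (K * kk) with hb
  have ha1 : 1 ≤ a := one_le_pow₀ hq1.le
  have hb1 : 1 ≤ b := one_le_pow₀ hq1.le
  have hab1 : 1 ≤ a * b := one_le_mul_of_one_le_of_one_le ha1 hb1
  have hpowk : ((Cq : ℝ) * (q : ℝ) ^ K) ^ kk = (Cq : ℝ) ^ kk * b := by
    rw [mul_pow, ← pow_mul]
  have hqm : (q : ℝ) ^ m = b * a * q := by rw [hm]; ring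
  have hqge : Cm * (Cq : ℝ) ^ kk + M + 2 ≤ q := by rw [hQ₀] at hqQ; linarith
  have hE : Cm * (Cq : ℝ) ^ kk * b + (a * M + 1) ≤ (q : ℝ) ^ m := by
    rw [hqm]
    have h1 : Cm * (Cq : ℝ) ^ kk * b ≤ Cm * (Cq : ℝ) ^ kk * (a * b) := by
      apply mul_le_mul_of_nonneg_left _ hMCE
      calc b = 1 * b := (one_mul b).symm
        _ ≤ a * b := by gcongr
    have h2 : a * M ≤ M * (a * b) := by
      calc a * M = M * (a * 1) := by ring
        _ ≤ M * (a * b) := by gcongr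
    have h3 : (1 : ℝ) ≤ 2 * (a * b) := by linarith
    have h4 : (Cm * (Cq : ℝ) ^ kk + M + 2) * (a * b) ≤ (q : ℝ) * (a * b) :=
      mul_le_mul_of_nonneg_right hqge (by positivity)
    nlinarith
  have h1 : a * M * Real.exp (-(q : ℝ) ^ m) ≤
      Real.exp (-(Cm * ((Cq : ℝ) * (q : ℝ) ^ K) ^ kk)) := by
    rw [hpowk, ← mul_assoc]
    have h3 : Real.exp (-(q : ℝ) ^ m) ≤
        Real.exp (-(a * M + 1)) * Real.exp (-(Cm * (Cq : ℝ) ^ kk * b)) := by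
      rw [← Real.exp_add]; exact Real.exp_le_exp.mpr (by linarith)
    have h4 : a * M * Real.exp (-(a * M + 1)) ≤ 1 := by
      have h5 := Real.add_one_le_exp (a * M + 1)
      rw [Real.exp_neg, mul_inv_le_iff₀ (Real.exp_pos _)]
      linarith
    have haM : 0 ≤ a * M := by positivity
    calc a * M * Real.exp (-(q : ℝ) ^ m)
        ≤ a * M * (Real.exp (-(a * M + 1)) * Real.exp (-(Cm * (Cq : ℝ) ^ kk * b))) :=
          mul_le_mul_of_nonneg_left h3 haM
      _ = (a * M * Real.exp (-(a * M + 1))) * Real.exp (-(Cm * (Cq : ℝ) ^ kk * b)) := by ring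
      _ ≤ 1 * Real.exp (-(Cm * (Cq : ℝ) ^ kk * b)) := by gcongr
      _ = _ := one_mul _
  exact absurd hchain (not_lt.mpr h1)

/-- **Weak class principle in several variables (kernel).** A tuple `θ` with an `MvWeakMeasure`
and a hyper-Liouville `ρ` form an algebraically independent `(n+1)`-tuple `(ρ, θ₁, …, θₙ)`. -/
theorem algebraicIndependent_option_of_mvWeakMeasure_hyperLiouville {n : ℕ} {θ : Fin n → ℂ}
    (hθ : MvWeakMeasure θ) {ρ : ℝ} (hρ : HyperLiouville ρ) :
    AlgebraicIndependent ℚ (fun o : Option (Fin n) => o.elim (ρ : ℂ) θ) := by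
  have hθi := algebraicIndependent_of_mvWeakMeasure hθ
  rw [hθi.option_iff_transcendental]
  intro halg
  obtain ⟨K, G, hGK, hrel⟩ := exists_int_mvrelation halg
  exact no_int_relation_of_mvWeakMeasure_hyperLiouville hθ hρ G ⟨Fin.last K, hGK⟩ hrel

/-- **The weakly-measured storey of A₄ʰ, EVERY LEVEL (kernel).** A ℚ-free hyper-Liouville tuple
`z : Fin (n+1) → ℂ` whose first two coordinates are proportional by a hyper-Liouville real and
whose Schanuel field `ℚ(z, e^z, i)` contains `n` numbers with a simultaneous weak measure has
Schanuel's bound: `trdeg ≥ n + 1`.  (At `n + 1 = 2` the proportionality is automatic: §17c.) -/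
theorem sb_of_hyperLiouville_ratio_of_mvWeakMeasure {n : ℕ} {z : Fin (n + 1) → ℂ}
    {ρ : ℝ} (hρ : HyperLiouville ρ) (hρz : (ρ : ℂ) ∈ adjoin ℚ (SFset z ∪ {I}))
    {θ : Fin n → ℂ} (hθ : MvWeakMeasure θ) (hθz : ∀ j, θ j ∈ adjoin ℚ (SFset z ∪ {I})) :
    SB (n + 1) z := by
  have hai := algebraicIndependent_option_of_mvWeakMeasure_hyperLiouville hθ hρ
  refine sb_of_algebraicIndependent hai (by simp) fun o => ?_
  cases o with
  | none => exact hρz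
  | some j => exact hθz j

/-- Level 2, several-variables form: a ℚ-free hyper-Liouville PAIR with ONE weakly measured
number (as a `Fin 1`-tuple) in its Schanuel field has Schanuel's bound. -/
theorem sb_two_of_hyperLinLiouville_of_mvWeakMeasure {z : Fin 2 → ℂ} (hz : LinearIndependent ℚ z)
    (hH : HyperLinLiouville z) {θ : Fin 1 → ℂ} (hθ : MvWeakMeasure θ)
    (hθz : ∀ j, θ j ∈ adjoin ℚ (SFset z ∪ {I})) : SB 2 z := by
  obtain ⟨ρ, hρ, h1⟩ := exists_hyperLiouville_ratio_of_hyperLinLiouville hz hH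
  have hρmem : (ρ : ℂ) ∈ adjoin ℚ (SFset z ∪ {I}) := by
    have : (ρ : ℂ) = z 1 / z 0 := by
      rw [h1, mul_div_assoc, div_self (hz.ne_zero 0), mul_one]
    rw [this]; exact ratio_mem_adjoin z
  exact sb_of_hyperLiouville_ratio_of_mvWeakMeasure hρ hρmem hθ hθz

/-- The Lindemann–Weierstrass storeys are weakly measured (mod `hLW`, via §10f's `MvPolyMeasure`):
`(t, ρt)` padded… more to the point, ANY ℚ-free hyper-Liouville tuple whose Schanuel field
contains `e^{y₁}, …, e^{yₙ}` with `yᵢ ∈ ℚ̄` ℚ-linearly independent gets `n + 1`. -/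
theorem sb_of_hyperLiouville_ratio_of_LW (hLW : LWMeasure) {n : ℕ} {z : Fin (n + 1) → ℂ}
    {ρ : ℝ} (hρ : HyperLiouville ρ) (hρz : (ρ : ℂ) ∈ adjoin ℚ (SFset z ∪ {I}))
    {y : Fin n → ℂ} (hy : ∀ i, IsAlgebraic ℚ (y i)) (hli : LinearIndependent ℚ y)
    (hmem : ∀ i, cexp (y i) ∈ adjoin ℚ (SFset z ∪ {I})) : SB (n + 1) z :=
  sb_of_hyperLiouville_ratio_of_mvWeakMeasure hρ hρz
    (MvPolyMeasure.mvWeakMeasure (mvPolyMeasure_exp_of_LW hLW hy hli)) hmem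

open Literature.NumberTheory.Transcendental in
/-- The affine Weil height of `![x]` is at most (in fact equal to) that of the `Unit`-tuple `x`. -/
private theorem weilHeight₁_vec_le (F : IntermediateField ℚ ℂ) [FiniteDimensional ℚ F] {x : ℂ}
    (hx : x ∈ F) : weilHeight₁ F ![x] ≤ weilHeight₁ F (fun _ : Unit => x) := by
  have e : (![x] : Fin 1 → ℂ) = (fun _ : Unit => x) ∘ (fun _ : Fin 1 => ()) := by
    funext i; simp
  rw [e]
  exact weilHeight₁_comp_le F (fun _ : Fin 1 => ()) (fun _ : Unit => x) (fun _ => hx)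

end HyperCell

end Summit.Schanuel.Schanuel.Theorems.RootDecomp1KHyper
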